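import Summits.BirchSwinnertonDyer.BirchSwinnertonDyer.Theorems.ManinLocalTwoThreeManinPrimeToAdditiveFiveLeRedOrdinaryStarredTwin
import Literature.NumberTheory.EllipticCurves.RootNumberProofs
import Literature.NumberTheory.EllipticCurves.RootNumberSmulProofs
import HarnessLib

/-!
# Route `ManinLocalTwoThree`, residual crux C5 `ManinPrimeToAdditiveFiveLe`
# (stmt-BirchSwinnertonDyer-22969), line `upper_anchor` (skeleton v10, registered stubs `stub_red7ordIV`,
# `stub_red57corner`): **the commuting starred twin packet WITHOUT the twist-minimality cut — only
# «`W ⊗ p*` is additive at `p`» is needed**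

Width seat bsd-line-ml23-c5-p1-w3 (gen 0), piece χ (sequel of φ, p628074 / p628721). The twin packet of
`…RedOrdinaryStarredTwin.lean` (`exists_commuting_starred_twin_of_ordinaryRamifiedTwistLaw`) carries the line's
ODD TWIST-MINIMALITY cut `hodd` («no semistable odd untwist of `W`»), used at exactly one point: to get
`p² ∣ N(W₀)` for the lattice-optimal curve `W₀` of the class of `W ⊗ p*`. Since skeleton v10 (lead gen 6) the
potentially-ordinary cells of the line are the route `TwistFamilyManinDescent`'s declared residual
`OrdinaryCornerManinResidual` (stmt-BirchSwinnertonDyer-27552) BY NAME (-w2's υ5), and THAT statement carries no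
twist-minimality, no `p ∣ deg`, no `N > 5·10⁵`, no `Iₙ*` binder — only «`W ⊗ p*` is neither good nor
multiplicative at `(p)`». This file re-cuts the packet on exactly that clause:

* §1 `sq_dvd_conductorNorm_of_isIsogenous_of_twist_pStar_additiveAt` — if `W ⊗ p*` is additive at the place
  `(p)` and `W ⊗ p* ∼ W₀` then `p² ∣ N(W₀)` (conductor is an isogeny invariant granted modularity; `f_p ≥ 2` iff
  additive); and `twist_pStar_additiveAt_of_isIsogenous_twist_pStar_of_sq_dvd` — conversely the twin's twist
  `W₀ ⊗ p* ∼ W` is additive at `(p)` when `p² ∣ N(W)`.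
* §2 `exists_commuting_starred_twin_of_twistAdditive_of_ordinaryRamifiedTwistLaw` — **THE PACKET, χ-form**:
  `p ≥ 5`, E-imc-9 `OrdinaryRamifiedTwistLaw p`, modularity, `W` globally minimal with a lattice-optimal
  conductor-level datum, `p² ∣ N(W)`, `W ⊗ p*` additive at `(p)`, `ord_p Δ_min(W) ≤ 4`, `e ∣ p − 1` ⟹ a
  lattice-optimal globally minimal commuting twin `W₀ = u • (W ⊗ p*)` with `N(W₀) = N(W)`, `p² ∣ N(W₀)`,
  `deg(D₀) = p · deg(D)`, `v_p c(D₀) = v_p c(D)`, `ord_p Δ_min(W₀) = ord_p Δ_min(W) + 6`. Same proof as φ's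
  packet (potential ordinarity DISCHARGED by §0 of the φ file; trichotomy cases (ii)/(iii) killed by E-imc-9's
  two clauses + the index engine at `s = 1`; near-invariance), with §1 in place of the twist-minimality step.
  The φ packet is the special case `hodd ⟹ twist additive` (-w2's `quadraticTwist_pStar_additive_of_twistMinimal`,
  p627706).

Consumer (part 2 of χ, separate file because it must import the route file `Theses.TwistFamilyManinDescent`):
`OrdinaryCornerManinResidual` (27552) ⟸ its STARRED rows ∧ E-imc-9(5) ∧ E-imc-9(7).

HONEST STATUS. Conditional results (`--supports`, helper): E-imc-9 is an OPEN conjecture of the cell; nothing here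
proves any stub, 27552, C5, Manin's conjecture or BSD. No summit statement is proved by this seat.

References: [EdixhovenManin1991] §4; [ZagierCMB1985] §1; [DiamondShurman2005] §5.8, Thm. 8.8.3;
[SilvermanATAEC1994] IV.10.2(c), IV Table 4.1; cell bsd-f2-manin MEMO-imc.md §10 (E-imc-9).
-/

set_option autoImplicit false
-- the Theorems namespace of this sub repeats the summit name by design (D-0017 nested layout)
set_option linter.dupNamespace false

noncomputable section

open scoped Classical NumberField

namespace Summit.BirchSwinnertonDyer.BirchSwinnertonDyer.Theorems

open WeierstrassCurve IsDedekindDomain IsDedekindDomain.HeightOneSpectrum Rat.HeightOneSpectrum NumberField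
  Literature.NumberTheory.EllipticCurves Literature.NumberTheory.EllipticCurves.ModularForms
  Literature.NumberTheory.EllipticCurves.Rank1Residual
  Literature.NumberTheory.DiophantineGeometry
  Summit.BirchSwinnertonDyer.Rank1Residual.ManinAdditive
  Summit.BirchSwinnertonDyer.Rank1Residual.Additive

/-! ## §1 «`W ⊗ p*` additive at `(p)`» ⟺-plumbing with `p² ∣ N` across the twist class -/

/-- **`W ⊗ p*` additive at `(p)` and `W ⊗ p* ∼ W₀` ⟹ `p² ∣ N(W₀)`** (granted modularity: the conductor is an
isogeny invariant, `conductorNorm_eq_of_isIsogenous_of_modularity`; `p² ∣ N` iff neither good nor multiplicative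
at `p`, `sq_dvd_conductorNorm_of_not_good_of_not_mult`, with the place/prime bridges of `RootNumberProofs`).
[cite: SilvermanATAEC1994, IV.10.2(c)] [cite: DiamondShurman2005, Thm. 8.8.3] -/
theorem sq_dvd_conductorNorm_of_isIsogenous_of_twist_pStar_additiveAt (hnf : exists_isNewformOf) {p : ℕ}
    (hp : p.Prime) {W W₀ : WeierstrassCurve ℚ} [W.IsElliptic] [W₀.IsElliptic]
    (htwadd : ¬ ((W.quadraticTwist (((-1 : ℤ) ^ (p / 2) * p : ℤ) : ℚ)).HasGoodReductionAt
          ((Rat.HeightOneSpectrum.primesEquiv (R := ℤ)).symm ⟨p, hp⟩) ∨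
        (W.quadraticTwist (((-1 : ℤ) ^ (p / 2) * p : ℤ) : ℚ)).HasMultiplicativeReductionAt
          ((Rat.HeightOneSpectrum.primesEquiv (R := ℤ)).symm ⟨p, hp⟩)))
    (hiso : IsIsogenous (W.quadraticTwist ((((-1 : ℤ) ^ (p / 2) * p : ℤ)) : ℚ)) W₀) :
    p ^ 2 ∣ W₀.conductorNorm ℤ := by
  haveI hpF : Fact p.Prime := ⟨hp⟩
  have hd0 : ((((-1 : ℤ) ^ (p / 2) * p : ℤ)) : ℚ) ≠ 0 := by
    push_cast
    exact mul_ne_zero (pow_ne_zero _ (by norm_num)) (by exact_mod_cast hp.ne_zero)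
  set T : WeierstrassCurve ℚ := W.quadraticTwist ((((-1 : ℤ) ^ (p / 2) * p : ℤ)) : ℚ) with hT
  haveI hTe : T.IsElliptic := W.isElliptic_quadraticTwist hd0
  have hN : T.conductorNorm ℤ = W₀.conductorNorm ℤ :=
    conductorNorm_eq_of_isIsogenous_of_modularity
      (nonempty_modularParametrizationData_of_exists_isNewformOf hnf
        IsNewformOf.exists_maninConstant_ne_zero_holds) _ _ hiso
  rw [← hN]
  refine sq_dvd_conductorNorm_of_not_good_of_not_mult ⟨fun hg ↦ htwadd (Or.inl ?_), fun hm ↦ htwadd (Or.inr ?_)⟩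
  · exact (T.hasGoodReductionAtPrime_iff_hasGoodReductionAt_holds ⟨p, hp⟩).mp hg
  · exact (T.hasMultiplicativeReductionAtPrime_iff_hasMultiplicativeReductionAt_holds ⟨p, hp⟩).mp hm

/-- **Conversely, along `W ∼ W₀ ⊗ p*` with `p² ∣ N(W)`: the twist `W₀ ⊗ p*` is additive at `(p)`** (same two
tools, read backwards). [cite: SilvermanATAEC1994, IV.10.2(c)] [cite: DiamondShurman2005, Thm. 8.8.3] -/
theorem twist_pStar_additiveAt_of_isIsogenous_twist_pStar_of_sq_dvd (hnf : exists_isNewformOf) {p : ℕ}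
    (hp : p.Prime) {W W₀ : WeierstrassCurve ℚ} [W.IsElliptic] [W₀.IsElliptic]
    (htw : IsIsogenous W (W₀.quadraticTwist ((((-1 : ℤ) ^ (p / 2) * p : ℤ)) : ℚ)))
    (hpN : p ^ 2 ∣ W.conductorNorm ℤ) :
    ¬ ((W₀.quadraticTwist (((-1 : ℤ) ^ (p / 2) * p : ℤ) : ℚ)).HasGoodReductionAt
          ((Rat.HeightOneSpectrum.primesEquiv (R := ℤ)).symm ⟨p, hp⟩) ∨
        (W₀.quadraticTwist (((-1 : ℤ) ^ (p / 2) * p : ℤ) : ℚ)).HasMultiplicativeReductionAt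
          ((Rat.HeightOneSpectrum.primesEquiv (R := ℤ)).symm ⟨p, hp⟩)) := by
  haveI hpF : Fact p.Prime := ⟨hp⟩
  have hd0 : ((((-1 : ℤ) ^ (p / 2) * p : ℤ)) : ℚ) ≠ 0 := by
    push_cast
    exact mul_ne_zero (pow_ne_zero _ (by norm_num)) (by exact_mod_cast hp.ne_zero)
  set T : WeierstrassCurve ℚ := W₀.quadraticTwist ((((-1 : ℤ) ^ (p / 2) * p : ℤ)) : ℚ) with hT
  haveI hTe : T.IsElliptic := W₀.isElliptic_quadraticTwist hd0
  have hN : W.conductorNorm ℤ = T.conductorNorm ℤ :=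
    conductorNorm_eq_of_isIsogenous_of_modularity
      (nonempty_modularParametrizationData_of_exists_isNewformOf hnf
        IsNewformOf.exists_maninConstant_ne_zero_holds) _ _ htw
  obtain ⟨hng, hnm⟩ := not_good_and_not_mult_of_sq_dvd_conductorNorm T (hN ▸ hpN)
  rintro (hg | hm)
  · exact hng ((T.hasGoodReductionAtPrime_iff_hasGoodReductionAt_holds ⟨p, hp⟩).mpr hg)
  · exact hnm ((T.hasMultiplicativeReductionAtPrime_iff_hasMultiplicativeReductionAt_holds ⟨p, hp⟩).mpr hm)

/-! ## §2 The twin packet, χ-form (twist-additivity instead of twist-minimality) -/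

/-- **THE TWIN PACKET (χ-form).** Granted modularity (`hnf`) and E-imc-9 `OrdinaryRamifiedTwistLaw p` (`hO`,
OPEN): a globally minimal `W` with a lattice-optimal conductor-level datum `D`, `p ≥ 5`, `p² ∣ N(W)`, `W ⊗ p*`
additive at `(p)`, `ord_p Δ_min(W) ≤ 4` and tame index `e ∣ p − 1` has a COMMUTING lattice-optimal globally
minimal twin `W₀ = u • (W ⊗ p*)`, `W ⊗ p* ∼ W₀`, `W ∼ W₀ ⊗ p*`, `N(W₀) = N(W)`, `p² ∣ N(W₀)`, with
`deg(D₀) = p · deg(D)`, `v_p c(D₀) = v_p c(D)`, `ord_p Δ_min(W₀) = ord_p Δ_min(W) + 6`. Proof = the φ packet's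
with §1 for `p² ∣ N(W₀)`. Conditional result; closes nothing.
[cite: ZagierCMB1985, §1] [cite: DiamondShurman2005, §5.8 and Thm. 8.8.3] [cite: EdixhovenManin1991, §4] -/
theorem exists_commuting_starred_twin_of_twistAdditive_of_ordinaryRamifiedTwistLaw (hnf : exists_isNewformOf)
    {p : ℕ} (hp : p.Prime) (h5 : 5 ≤ p) (hO : OrdinaryRamifiedTwistLaw p)
    (W : WeierstrassCurve ℚ) [W.IsElliptic] [W.IsGloballyMinimal] [NeZero (W.conductorNorm ℤ)]
    (D : ModularParametrizationData W (W.conductorNorm ℤ)) (hD : IsLatticeOptimal D)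
    (hpN : p ^ 2 ∣ W.conductorNorm ℤ)
    (htwadd : ¬ ((W.quadraticTwist (((-1 : ℤ) ^ (p / 2) * p : ℤ) : ℚ)).HasGoodReductionAt
          ((Rat.HeightOneSpectrum.primesEquiv (R := ℤ)).symm ⟨p, hp⟩) ∨
        (W.quadraticTwist (((-1 : ℤ) ^ (p / 2) * p : ℤ) : ℚ)).HasMultiplicativeReductionAt
          ((Rat.HeightOneSpectrum.primesEquiv (R := ℤ)).symm ⟨p, hp⟩)))
    (hv4 : padicValInt p W.minimalDiscriminantInt ≤ 4)
    (he : 12 / Nat.gcd 12 (padicValInt p W.minimalDiscriminantInt) ∣ p - 1) :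
    ∃ (W₀ : WeierstrassCurve ℚ) (_ : W₀.IsElliptic) (_ : W₀.IsGloballyMinimal)
      (_ : NeZero (W₀.conductorNorm ℤ)) (u : VariableChange ℚ)
      (D₀ : ModularParametrizationData W₀ (W₀.conductorNorm ℤ)),
      IsLatticeOptimal D₀ ∧ u • W.quadraticTwist ((((-1 : ℤ) ^ (p / 2) * p : ℤ)) : ℚ) = W₀ ∧
      IsIsogenous (W.quadraticTwist ((((-1 : ℤ) ^ (p / 2) * p : ℤ)) : ℚ)) W₀ ∧
      IsIsogenous W (W₀.quadraticTwist ((((-1 : ℤ) ^ (p / 2) * p : ℤ)) : ℚ)) ∧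
      W₀.conductorNorm ℤ = W.conductorNorm ℤ ∧ p ^ 2 ∣ W₀.conductorNorm ℤ ∧
      D₀.modularDegree = p * D.modularDegree ∧ padicValInt p D₀.c = padicValInt p D.c ∧
      padicValInt p W₀.minimalDiscriminantInt = padicValInt p W.minimalDiscriminantInt + 6 := by
  haveI hpF : Fact p.Prime := ⟨hp⟩
  have hp2 : p ≠ 2 := by omega
  have hd0 : ((((-1 : ℤ) ^ (p / 2) * p : ℤ)) : ℚ) ≠ 0 := by
    push_cast
    exact mul_ne_zero (pow_ne_zero _ (by norm_num)) (by exact_mod_cast hp.ne_zero)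
  haveI : (W.quadraticTwist ((((-1 : ℤ) ^ (p / 2) * p : ℤ)) : ℚ)).IsElliptic := W.isElliptic_quadraticTwist hd0
  -- the lattice-optimal globally minimal curve `W₀` of the class of `W ⊗ p*`
  obtain ⟨W₀, hE₀, hM₀, hne₀, D₀, hD₀, hiso⟩ :=
    exists_isIsogenous_latticeOptimal hnf (W.quadraticTwist ((((-1 : ℤ) ^ (p / 2) * p : ℤ)) : ℚ))
  haveI := hE₀
  haveI := hM₀
  haveI := hne₀
  haveI : (W₀.quadraticTwist ((((-1 : ℤ) ^ (p / 2) * p : ℤ)) : ℚ)).IsElliptic := W₀.isElliptic_quadraticTwist hd0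
  haveI : ((W.quadraticTwist ((((-1 : ℤ) ^ (p / 2) * p : ℤ)) : ℚ)).quadraticTwist
      ((((-1 : ℤ) ^ (p / 2) * p : ℤ)) : ℚ)).IsElliptic :=
    (W.quadraticTwist ((((-1 : ℤ) ^ (p / 2) * p : ℤ)) : ℚ)).isElliptic_quadraticTwist hd0
  -- `W ∼ W₀ ⊗ p*`
  have htw : IsIsogenous W (W₀.quadraticTwist ((((-1 : ℤ) ^ (p / 2) * p : ℤ)) : ℚ)) := by
    obtain ⟨Cq, hCq⟩ := W.exists_variableChange_smul_eq_quadraticTwist_sq hd0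
    have h1 : IsIsogenous W ((W.quadraticTwist ((((-1 : ℤ) ^ (p / 2) * p : ℤ)) : ℚ)).quadraticTwist
        ((((-1 : ℤ) ^ (p / 2) * p : ℤ)) : ℚ)) := by
      rw [quadraticTwist_quadraticTwist, ← sq, ← hCq]
      exact isIsogenous_smul _ _
    exact h1.trans' (hiso.quadraticTwist hd0)
  -- `W ⊗ p*` additive at `(p)`: `p² ∣ N(W₀)` (§1); hence `N(W₀) = N(W)`
  have hpN₀ : p ^ 2 ∣ W₀.conductorNorm ℤ :=
    sq_dvd_conductorNorm_of_isIsogenous_of_twist_pStar_additiveAt hnf hp htwadd hiso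
  have hNN : W₀.conductorNorm ℤ = W.conductorNorm ℤ :=
    conductorNorm_eq_of_isIsogenous_twist_pStar_of_sq_dvd hnf h5 htw hpN hpN₀
  have hadd : Addv W p := not_good_and_not_mult_of_sq_dvd_conductorNorm W hpN
  -- `0 ≤ ord_p j(W)`: a globally minimal model `W₁ = C₀ • (W ⊗ p*)` has `N(W₁) = N(W₀)` (modularity), so it is
  -- additive at `p` too, and a commuting `χ_{p*}`-pair additive on both sides is potentially good
  obtain ⟨C₀, hmin⟩ := hasGlobalMinimalModel_rat_holds (W.quadraticTwist ((((-1 : ℤ) ^ (p / 2) * p : ℤ)) : ℚ))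
  haveI := hmin
  have hiso1 : IsIsogenous (C₀ • W.quadraticTwist ((((-1 : ℤ) ^ (p / 2) * p : ℤ)) : ℚ)) W₀ :=
    (isIsogenous_of_smul (W.quadraticTwist ((((-1 : ℤ) ^ (p / 2) * p : ℤ)) : ℚ)) C₀).trans' hiso
  have hN1 : (C₀ • W.quadraticTwist ((((-1 : ℤ) ^ (p / 2) * p : ℤ)) : ℚ)).conductorNorm ℤ =
      W₀.conductorNorm ℤ :=
    conductorNorm_eq_of_isIsogenous_of_modularity
      (nonempty_modularParametrizationData_of_exists_isNewformOf hnf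
        IsNewformOf.exists_maninConstant_ne_zero_holds) _ _ hiso1
  haveI : NeZero ((C₀ • W.quadraticTwist ((((-1 : ℤ) ^ (p / 2) * p : ℤ)) : ℚ)).conductorNorm ℤ) :=
    ⟨by rw [hN1]; exact NeZero.ne _⟩
  have hadd₁ : Addv (C₀ • W.quadraticTwist ((((-1 : ℤ) ^ (p / 2) * p : ℤ)) : ℚ)) p :=
    not_good_and_not_mult_of_sq_dvd_conductorNorm _ (by rw [hN1]; exact hpN₀)
  have hj : 0 ≤ padicValRat p W.j := padicValRat_j_nonneg_of_pStar_pair_addv hp2 C₀ rfl hadd hadd₁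
  -- potential ordinarity of `W` at `p`, discharged (§0)
  obtain ⟨hpo, -, -⟩ :=
    hasPotentiallyGoodOrdinaryReductionAtPrime_of_unstarred_of_semistabilityIndex_dvd W p h5 hadd hj hv4 he
  have hv6 : padicValInt p W.minimalDiscriminantInt < 6 := by omega
  have hpos : 0 < D.modularDegree := D.deg_pos
  -- the optimal-orbit trichotomy: E-imc-9 leaves only case (i)
  have hcomm : (∃ u : VariableChange ℚ, u • W.quadraticTwist ((((-1 : ℤ) ^ (p / 2) * p : ℤ)) : ℚ) = W₀) ∧
      D₀.modularDegree = p * D.modularDegree := by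
    rcases pStar_optimal_orbit_trichotomy_full hp hp2 W W₀ D D₀ hD hD₀ hpN hNN hiso with
      ⟨hu, hdeg, -⟩ | ⟨⟨u, hu⟩, hdeg, -⟩ | hdeg
    · exact ⟨hu, hdeg⟩
    · -- case (ii): clause 2 of E-imc-9 with `C = u` gives `deg₀ = p·deg`, against `p·deg₀ = deg > 0`
      exfalso
      have h := (hO W W₀ D u hp h5 hpN hpo hv6 hD hu).2 D₀ hD₀
      have : p * (p * D.modularDegree) = D.modularDegree := by rw [← h]; exact hdeg
      nlinarith [hp.two_le]
    · -- case (iii), the flip `deg₀ = deg`: impossible under E-imc-9 (υ2's argument at a general `p`)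
      exfalso
      -- E-imc-9: the twist model `W₁ = C₀ • (W ⊗ p*)` is optimal, with degree `p·deg`
      obtain ⟨⟨D₁, hD₁⟩, hall⟩ :=
        hO W (C₀ • W.quadraticTwist ((((-1 : ℤ) ^ (p / 2) * p : ℤ)) : ℚ)) D C₀ hp h5 hpN hpo hv6 hD rfl
      have hdeg₁ : D₁.modularDegree = p * D.modularDegree := hall D₁ hD₁
      -- the two optimal data of the class share the newform's period lattice
      have hcoefEq : ∀ n : ℕ, cuspCoeff D₁.f n = cuspCoeff D₀.f n := fun n ↦ by
        rw [D₁.isNewformOf.2 n, D₀.isNewformOf.2 n, hiso1.LFunction_eq]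
      have hΛ : periodLattice D₁.f = periodLattice D₀.f :=
        periodLattice_eq_of_level_eq_of_cuspCoeff_eq hN1 D₁.f D₀.f hcoefEq
      have h1 : ∀ w ∈ periodLattice D₁.f, (1 : ℂ) * w ∈ periodLattice D₀.f := fun w hw ↦ by
        rw [one_mul, ← hΛ]; exact hw
      have h2 : ∀ w ∈ periodLattice D₀.f, (1 : ℂ) * w ∈ periodLattice D₁.f := fun w hw ↦ by
        rw [one_mul, hΛ]; exact hw
      have hcoef : ∀ n : ℕ, ‖cuspCoeff D₁.f n‖ = ‖cuspCoeff D₀.f n‖ := fun n ↦ by rw [hcoefEq]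
      have ha : ‖(1 : ℂ)‖ ^ 2 = ((1 : ℕ) : ℝ) := by simp
      have hc' : (D₀.c : ℂ) ≠ 0 := by exact_mod_cast D₀.maninConstant_ne_zero_holds
      have hc₁ : (D₁.c : ℂ) ≠ 0 := by exact_mod_cast D₁.maninConstant_ne_zero_holds
      have ht : (D₀.c : ℂ) * 1 / (D₁.c : ℂ) ≠ 0 := div_ne_zero (by rw [mul_one]; exact hc') hc₁
      have ht' : (D₁.c : ℂ) * 1 / (D₀.c : ℂ) ≠ 0 := div_ne_zero (by rw [mul_one]; exact hc₁) hc'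
      obtain ⟨hmm, hmdeg⟩ := optimal_orbit_index_engine hN1 D₀ D₁ hD₀ hD₁ ha h1 h2 hcoef ht ht'
      rw [one_pow] at hmm
      have hm1 := Nat.eq_one_of_mul_eq_one_right hmm
      rw [hm1, one_mul, one_mul] at hmdeg
      -- `deg(D₁) = deg(D₀) = deg(D)` against `deg(D₁) = p·deg(D)`, `deg(D) > 0`, `p ≥ 5`
      have : p * D.modularDegree = D.modularDegree := by omega
      nlinarith [hp.two_le]
  obtain ⟨⟨u, hu⟩, hup⟩ := hcomm
  -- near-invariance along the commuting pair: `v_p c₀ = v_p c`, `ord_p Δ_min(W₀) = ord_p Δ_min(W) + 6`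
  rcases pStar_optimal_commuting_manin_near_invariance hp hp2 W W₀ u D D₀ hD hD₀ hpN hNN hu with
    ⟨-, ⟨hc, hΔ⟩ | ⟨-, hΔ⟩⟩ | ⟨hdeg₂, -⟩
  · exact ⟨W₀, hE₀, hM₀, hne₀, u, D₀, hD₀, hu, hiso, htw, hNN, hpN₀, hup, hc, hΔ⟩
  · -- `ord_p Δ_min(W₀) + 6 = ord_p Δ_min(W) ≤ 4` is absurd
    omega
  · -- `p·deg₀ = deg` against `deg₀ = p·deg > 0`
    have : p * (p * D.modularDegree) = D.modularDegree := by rw [← hup]; exact hdeg₂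
    nlinarith [hp.two_le]

end Summit.BirchSwinnertonDyer.BirchSwinnertonDyer.Theorems

end
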